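import Summits.AtomisticToContinuum.BoseEinsteinCondensation.Theorems.BECRewardDescentRewardChordBoundRewardedClassFRHelpers
-- module: Summits.AtomisticToContinuum.BoseEinsteinCondensation.Theorems.BECRewardDescentRewardChordBoundRewardedClassFR

/-!
# Stub R1 `stub_rewardedClassFR` of crux `RewardChordBound` (stmt-AtomisticToContinuum-12876):
# the rewarded maximal-form ground-state class for finite-range potentials, hard cores allowed

For a repulsive finite-range pair profile `v` (hard cores allowed), `L > 0`, `N ≥ 1`, `s > 0` and the `C¹` rewarded
infimum `R = inf_Ψ (E_v[Ψ] + s(N - n₀(Ψ))) < ⊤` over periodic Bose trial states on the torus `(ℝ³/Lℤ³)^N`, the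
class `M = {η ∈ boseSymmetric N | maxFormR s v L η ≤ R‖η‖²}` of `L²((ℝ/ℤ)^{3N})` has all the properties of the
integrable rewarded ground-state class: the rewarded maximal-form bound `R‖ξ‖² ≤ maxFormR ξ` on the Bose sector,
the rewarded Euler–Lagrange identity, closure under `+`, `ℂ•`, `|·|`, `conj`, finiteness of the maximal form,
stability under diagonal translations, closedness (helper file `…RewardedClassFRHelpers`), a unit element, and
Rellich compactness of near-minimising cell-orthogonal pairs (this file: `exists_limit_of_rewarded_le`,
compactness with memory through the FREE form domain, `exists_limitProfile_of_seq`, plus lower semicontinuity of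
the rewarded maximal form through the truncations `min(v, m)` and the depletion dictionary
`E_v[Ψ] + s(N - n₀(Ψ)) = maxFormR(ι₀Ψ)`; orthogonality passes to the limit by `inner_formEmbed_graphEmbed`).

References: [ReedSimonIV1978] §XIII.12 and Thm XIII.64; [Simon1979Forms] Thm. 2.1.
-/

noncomputable section

open MeasureTheory Filter Set Complex UnitAddTorus
open scoped ENNReal NNReal Topology InnerProductSpace ComplexConjugate
open Literature.Analysis.FunctionSpaces Literature.Analysis.OperatorTheory Literature.Analysis.InnerProduct

namespace Summit.AtomisticToContinuum.BoseEinsteinCondensation.Cruxes.RewardChordBound.Birth.RewardedClassFR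

open Literature.MathematicalPhysics.QuantumManyBody.BoseGas
open Summit.AtomisticToContinuum.BoseEinsteinCondensation.Cruxes.StaticResponseBound.UvThomsonForceWave
  (measurable_zeroProfile lintegral_periodicInteraction_zero_ne_top periodicEnergy_truncPotential_le')
open Summit.AtomisticToContinuum.BoseEinsteinCondensation.Cruxes.HardCoreExtension.ThirdLawCurrentFloor
  (exists_limitProfile_of_seq)

-- The measure on `ℝ/ℤ` is the Haar PROBABILITY measure, as in `PeriodicFormDomain.lean`.
attribute [local instance] Literature.MathematicalPhysics.QuantumManyBody.BoseGas.formDomain_measureSpace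
  Literature.MathematicalPhysics.QuantumManyBody.BoseGas.formDomain_isProbabilityMeasure
  Literature.MathematicalPhysics.QuantumManyBody.BoseGas.formDomain_isProbabilityMeasure_pi

variable {N : ℕ} {L : ℝ} {v : ℝ → ℝ≥0∞} {s : ℝ}

/-- Local notation for the Hilbert space `L²((ℝ/ℤ)^{3N})`, as in `PeriodicFormDomain.lean`. -/
local notation "L2T " N':max => Lp ℂ 2 (volume : Measure (UnitAddTorus (Fin N' × Fin 3)))

/-! ### Part C — Rellich compactness of rewarded near-minimising sequences through the free form domain -/

section Compactness

/-- **Compactness of rewarded near-minimising sequences (with memory of the subsequence).** For a repulsive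
finite-range `v` (hard cores allowed), `L > 0`, `s ≥ 0`, a finite level `R` and periodic trial states `A_k`
with `E_v[A_k] + s(N - n₀(A_k)) ≤ R + ε_k`, `ε_k → 0`: along a subsequence the freely embedded classes `ι₀A_k`
converge in `L²((ℝ/ℤ)^{3N})` to a unit Bose-symmetric `η` with `maxFormR s v L η ≤ R` (Rellich through the free
form domain, `exists_limitProfile_of_seq`, on a tail where `ε_k ≤ 1`; then lower semicontinuity of the rewarded
maximal form, `maxFormR_le_of_tendsto_fr`, and the dictionary `E_v[Ψ] + s(N - n₀(Ψ)) = maxFormR(ι₀Ψ)`).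
[cite: ReedSimonIV1978, Thm. XIII.64] -/
theorem exists_limit_of_rewarded_le (hv : IsRepulsiveFiniteRange v) (hL : 0 < L) (hs : 0 ≤ s) {R : ℝ≥0∞}
    (hR : R ≠ ⊤) (A : ℕ → PeriodicTrialState N L) {ε : ℕ → ℝ≥0∞} (hε : Tendsto ε atTop (𝓝 0))
    (hA : ∀ k, periodicEnergy v (A k) + ENNReal.ofReal s * ((N : ℝ≥0∞) - condensateOccupation N L (A k).ψ) ≤
      R + ε k) :
    ∃ (η : L2T N) (φ : ℕ → ℕ), StrictMono φ ∧
      Tendsto (fun i => formEmbed hL measurable_zeroProfile (lintegral_periodicInteraction_zero_ne_top N L)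
        ⟨graphEmbed hL measurable_zeroProfile (lintegral_periodicInteraction_zero_ne_top N L)
          ⟨(A (φ i)).ψ, (A (φ i)).mem_periodicCore⟩, graphEmbed_mem_formDomain _ _ _ _⟩) atTop (𝓝 η) ∧
      ‖η‖ = 1 ∧ η ∈ boseSymmetric N ∧ maxFormR s v L η ≤ R := by
  -- a tail along which `ε ≤ 1`, so that the energies are bounded by `R + 1 < ∞`
  obtain ⟨K, hK⟩ := eventually_atTop.1 (hε.eventually (Iic_mem_nhds one_pos))
  have hB : R + 1 ≠ ⊤ := ENNReal.add_ne_top.2 ⟨hR, ENNReal.one_ne_top⟩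
  have hbd : ∀ i, periodicEnergy (truncPotential v i) (A (i + K)) ≤ R + 1 := fun i =>
    calc periodicEnergy (truncPotential v i) (A (i + K)) ≤ periodicEnergy v (A (i + K)) :=
          periodicEnergy_truncPotential_le' v i _
      _ ≤ periodicEnergy v (A (i + K)) +
            ENNReal.ofReal s * ((N : ℝ≥0∞) - condensateOccupation N L (A (i + K)).ψ) := le_self_add
      _ ≤ R + ε (i + K) := hA _
      _ ≤ R + 1 := add_le_add le_rfl (hK _ (Nat.le_add_left K i))
  obtain ⟨η, φ, hφ, hconv, hnorm, hsymm, -⟩ := exists_limitProfile_of_seq hv.1 hL hB (fun i => A (i + K)) hbd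
  refine ⟨η, fun i => φ i + K, fun a b hab => Nat.add_lt_add_right (hφ hab) K, hconv, hnorm, hsymm, ?_⟩
  -- `maxFormR η ≤ R` by lower semicontinuity of the rewarded maximal form
  refine maxFormR_le_of_tendsto_fr hv hL hconv (c := fun i => R + ε (φ i + K)) (fun i => ?_) ?_
  · rw [← rewardedF_eq_maxFormR hL hv.1 hs]
    exact hA _
  · have h := (hε.comp ((tendsto_add_atTop_nat K).comp hφ.tendsto_atTop)).const_add R
    rwa [add_zero] at h

/-- **The rewarded class has a unit element** when `R = inf_Ψ (E_v[Ψ] + s(N - n₀(Ψ))) < ∞` (`s ≥ 0`): the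
`L²`-limit of (the free embeddings of) a minimising sequence. [cite: ReedSimonIV1978, Thm. XIII.64] -/
theorem exists_mem_classFR_norm_eq_one (hv : IsRepulsiveFiniteRange v) (hL : 0 < L) (hs : 0 ≤ s)
    (hR : (⨅ Ψ : PeriodicTrialState N L,
      (periodicEnergy v Ψ + ENNReal.ofReal s * ((N : ℝ≥0∞) - condensateOccupation N L Ψ.ψ))) ≠ ⊤) :
    ∃ η : L2T N, (η ∈ boseSymmetric N ∧ maxFormR s v L η ≤
      (⨅ Ψ : PeriodicTrialState N L,
        (periodicEnergy v Ψ + ENNReal.ofReal s * ((N : ℝ≥0∞) - condensateOccupation N L Ψ.ψ))) *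
          ENNReal.ofReal (‖η‖ ^ 2)) ∧ ‖η‖ = 1 := by
  set R : ℝ≥0∞ := ⨅ Ψ : PeriodicTrialState N L,
      (periodicEnergy v Ψ + ENNReal.ofReal s * ((N : ℝ≥0∞) - condensateOccupation N L Ψ.ψ)) with hRdef
  -- a minimising sequence
  set e : ℕ → ℝ≥0∞ := fun j => ((j : ℝ≥0∞) + 1)⁻¹ with he
  have he0 : ∀ j, e j ≠ 0 := fun j =>
    ENNReal.inv_ne_zero.2 (ENNReal.add_ne_top.2 ⟨ENNReal.natCast_ne_top j, ENNReal.one_ne_top⟩)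
  have helim : Tendsto e atTop (𝓝 0) := by
    have h : Tendsto (fun j : ℕ => (j : ℝ≥0∞) + 1) atTop (𝓝 ⊤) := by
      have h1 := ENNReal.tendsto_nat_nhds_top.comp (tendsto_add_atTop_nat 1)
      refine h1.congr fun j => ?_
      simp only [Function.comp_apply, Nat.cast_add, Nat.cast_one]
    have h2 := (tendsto_inv_iff (G := ℝ≥0∞) (a := (⊤ : ℝ≥0∞))).2 h
    rwa [ENNReal.inv_top] at h2
  have hmin : ∀ j : ℕ, ∃ Ψ : PeriodicTrialState N L,
      periodicEnergy v Ψ + ENNReal.ofReal s * ((N : ℝ≥0∞) - condensateOccupation N L Ψ.ψ) < R + e j := fun j =>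
    iInf_lt_iff.1 (ENNReal.lt_add_right hR (he0 j))
  choose Ψ hΨ using hmin
  obtain ⟨η, φ, -, -, hnorm, hsymm, hRη⟩ := exists_limit_of_rewarded_le hv hL hs hR Ψ helim fun j => (hΨ j).le
  refine ⟨η, ⟨hsymm, ?_⟩, hnorm⟩
  rw [hnorm, one_pow, ENNReal.ofReal_one, mul_one]
  exact hRη

/-- **Rellich compactness of rewarded near-minimising cell-orthogonal pairs** (finite level `R`, `s ≥ 0`): if
`E_v[A_k] + s(N - n₀(A_k)) ≤ R + ε_k`, `E_v[B_k] + s(N - n₀(B_k)) ≤ R + ε_k`, `ε_k → 0` and `A_k ⊥ B_k` in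
`L²(cell)`, then the `L²((ℝ/ℤ)^{3N})`-limits (along a common subsequence) of `ι₀A_k`, `ι₀B_k` are an ORTHOGONAL
pair of unit Bose-symmetric classes with `maxFormR ≤ R‖·‖²` (`⟪ι₀A_k, ι₀B_k⟫ = ∫_cell conj(A_k) B_k = 0`,
`inner_formEmbed_graphEmbed`, and continuity of the inner product). [cite: ReedSimonIV1978, Thm. XIII.64] -/
theorem exists_orthogonal_pair_of_rewarded_le (hv : IsRepulsiveFiniteRange v) (hL : 0 < L) (hs : 0 ≤ s)
    {R : ℝ≥0∞} (hR : R ≠ ⊤) (A B : ℕ → PeriodicTrialState N L) {ε : ℕ → ℝ≥0∞} (hε : Tendsto ε atTop (𝓝 0))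
    (hA : ∀ k, periodicEnergy v (A k) + ENNReal.ofReal s * ((N : ℝ≥0∞) - condensateOccupation N L (A k).ψ) ≤
      R + ε k)
    (hB : ∀ k, periodicEnergy v (B k) + ENNReal.ofReal s * ((N : ℝ≥0∞) - condensateOccupation N L (B k).ψ) ≤
      R + ε k)
    (horth : ∀ k, (∫ X in cellN N L, conj ((A k).ψ X) * (B k).ψ X) = 0) :
    ∃ ηA : L2T N, (ηA ∈ boseSymmetric N ∧ maxFormR s v L ηA ≤ R * ENNReal.ofReal (‖ηA‖ ^ 2)) ∧
      ∃ ηB : L2T N, (ηB ∈ boseSymmetric N ∧ maxFormR s v L ηB ≤ R * ENNReal.ofReal (‖ηB‖ ^ 2)) ∧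
        ‖ηA‖ = 1 ∧ ‖ηB‖ = 1 ∧ ⟪ηA, ηB⟫_ℂ = 0 := by
  -- compactness with memory, twice
  obtain ⟨ηA, φ, hφ, hconvA, hnormA, hsymmA, hRA⟩ := exists_limit_of_rewarded_le hv hL hs hR A hε hA
  obtain ⟨ηB, ψ, hψ, hconvB, hnormB, hsymmB, hRB⟩ :=
    exists_limit_of_rewarded_le hv hL hs hR (fun i => B (φ i)) (hε.comp hφ.tendsto_atTop) fun i => hB (φ i)
  refine ⟨ηA, ⟨hsymmA, ?_⟩, ηB, ⟨hsymmB, ?_⟩, hnormA, hnormB, ?_⟩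
  · rw [hnormA, one_pow, ENNReal.ofReal_one, mul_one]
    exact hRA
  · rw [hnormB, one_pow, ENNReal.ofReal_one, mul_one]
    exact hRB
  -- orthogonality passes to the limit
  have hlim := Filter.Tendsto.inner (𝕜 := ℂ) (hconvA.comp hψ.tendsto_atTop) hconvB
  have hzero : ∀ i,
      ⟪formEmbed hL measurable_zeroProfile (lintegral_periodicInteraction_zero_ne_top N L)
          ⟨graphEmbed hL measurable_zeroProfile (lintegral_periodicInteraction_zero_ne_top N L)
            ⟨(A (φ (ψ i))).ψ, (A (φ (ψ i))).mem_periodicCore⟩, graphEmbed_mem_formDomain _ _ _ _⟩,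
        formEmbed hL measurable_zeroProfile (lintegral_periodicInteraction_zero_ne_top N L)
          ⟨graphEmbed hL measurable_zeroProfile (lintegral_periodicInteraction_zero_ne_top N L)
            ⟨(B (φ (ψ i))).ψ, (B (φ (ψ i))).mem_periodicCore⟩, graphEmbed_mem_formDomain _ _ _ _⟩⟫_ℂ = 0 := by
    intro i
    rw [inner_formEmbed_graphEmbed]
    exact horth _
  have hconst : Tendsto (fun i : ℕ =>
      ⟪formEmbed hL measurable_zeroProfile (lintegral_periodicInteraction_zero_ne_top N L)
          ⟨graphEmbed hL measurable_zeroProfile (lintegral_periodicInteraction_zero_ne_top N L)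
            ⟨(A (φ (ψ i))).ψ, (A (φ (ψ i))).mem_periodicCore⟩, graphEmbed_mem_formDomain _ _ _ _⟩,
        formEmbed hL measurable_zeroProfile (lintegral_periodicInteraction_zero_ne_top N L)
          ⟨graphEmbed hL measurable_zeroProfile (lintegral_periodicInteraction_zero_ne_top N L)
            ⟨(B (φ (ψ i))).ψ, (B (φ (ψ i))).mem_periodicCore⟩, graphEmbed_mem_formDomain _ _ _ _⟩⟫_ℂ)
      atTop (𝓝 0) := by
    simp only [hzero]
    exact tendsto_const_nhds
  exact tendsto_nhds_unique hlim hconst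

end Compactness

end Summit.AtomisticToContinuum.BoseEinsteinCondensation.Cruxes.RewardChordBound.Birth.RewardedClassFR

namespace Summit.AtomisticToContinuum.BoseEinsteinCondensation.Cruxes.RewardChordBound.Birth

open Literature.MathematicalPhysics.QuantumManyBody.BoseGas
open Summit.AtomisticToContinuum.BoseEinsteinCondensation.Cruxes.RewardChordBound.Birth.RewardedClassFR

-- The measure on `ℝ/ℤ` is the Haar PROBABILITY measure, as in `PeriodicFormDomain.lean`.
attribute [local instance] Literature.MathematicalPhysics.QuantumManyBody.BoseGas.formDomain_measureSpace
  Literature.MathematicalPhysics.QuantumManyBody.BoseGas.formDomain_isProbabilityMeasure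
  Literature.MathematicalPhysics.QuantumManyBody.BoseGas.formDomain_isProbabilityMeasure_pi

/-- **stub R1 — `RewardedClassFR`: the rewarded maximal-form ground-state class for finite-range potentials, hard
cores allowed.** For `L > 0`, `N ≥ 1`, `s > 0`, a repulsive finite-range `v` and
`R := inf_Ψ (E_v[Ψ] + s(N - n₀(Ψ))) < ⊤` (the `C¹` rewarded infimum), with
`M := {η ∈ boseSymmetric N | maxFormR s v L η ≤ R‖η‖²}`: (a) the rewarded max-form bound on the Bose sector
(hard-core MaxFormApproximation `stub_maxFormApproximationFiniteRange` + the depletion dictionary + the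
`L²`-Lipschitz bound of the depletion); (b) the Euler–Lagrange identity
`KinB(η,ξ) + PotB(η,ξ) + s·DepB(η,ξ) = R re⟪η,ξ⟫` at `η ∈ M` against Bose-symmetric `ξ` of finite maximal form
(`toReal_maxForm_add_smul_c2`); (c) `M` is closed under `+`, `ℂ•`, `|·|`, `conj`, and its elements have finite
maximal form; (e) `M` is stable under the diagonal translations `T_b`; (f) `M` is closed in `L²` (lower
semicontinuity of the rewarded maximal form through the truncations `min(v, m)`); (d') `M` has a unit element;
(d) Rellich compactness of near-minimising cell-orthogonal pairs of `C¹` states through the FREE form domain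
(`exists_limitProfile_of_seq`): their `L²` limits are an ORTHOGONAL pair of unit elements of `M`.
[cite: ReedSimonIV1978, §XIII.12 and Thm XIII.64; Simon1979Forms, Thm. 2.1] -/
theorem stub_rewardedClassFR :
    ∀ (N : ℕ) (L : ℝ) (v : ℝ → ENNReal) (s : ℝ) (hL : 0 < L), Literature.MathematicalPhysics.QuantumManyBody.BoseGas.IsRepulsiveFiniteRange v → 1 ≤ N → 0 < s → let R : ENNReal := ⨅ Ψ : Literature.MathematicalPhysics.QuantumManyBody.BoseGas.PeriodicTrialState N L, (Literature.MathematicalPhysics.QuantumManyBody.BoseGas.periodicEnergy v Ψ + ENNReal.ofReal s * ((N : ENNReal) - Literature.MathematicalPhysics.QuantumManyBody.BoseGas.condensateOccupation N L Ψ.ψ)); R ≠ ⊤ → let M : Set (MeasureTheory.Lp ℂ 2 (MeasureTheory.Measure.pi fun _ : Fin N × Fin 3 => (AddCircle.haarAddCircle : MeasureTheory.Measure UnitAddCircle))) := {η | η ∈ Literature.MathematicalPhysics.QuantumManyBody.BoseGas.boseSymmetric N ∧ Literature.MathematicalPhysics.QuantumManyBody.BoseGas.maxFormR s v L η ≤ R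 * ENNReal.ofReal (‖η‖ ^ 2)}; (∀ ξ : MeasureTheory.Lp ℂ 2 (MeasureTheory.Measure.pi fun _ : Fin N × Fin 3 => (AddCircle.haarAddCircle : MeasureTheory.Measure UnitAddCircle)), ξ ∈ Literature.MathematicalPhysics.QuantumManyBody.BoseGas.boseSymmetric N → R * ENNReal.ofReal (‖ξ‖ ^ 2) ≤ Literature.MathematicalPhysics.QuantumManyBody.BoseGas.maxFormR s v L ξ) ∧ (∀ η ∈ M, ∀ ξ : MeasureTheory.Lp ℂ 2 (MeasureTheory.Measure.pi fun _ : Fin N × Fin 3 => (AddCircle.haarAddCircle : MeasureTheory.Measure UnitAddCircle)), ξ ∈ Literature.MathematicalPhysics.QuantumManyBody.BoseGas.boseSymmetric N → Literature.MathematicalPhysics.QuantumManyBody.BoseGas.maxForm v L ξ ≠ ⊤ → Literature.MathematicalPhysics.QuantumManyBody.BoseGas.maxFormKinB L η ξ + Literature.MathematicalPhysics.QuantumManyBody.BoseGas.maxFormPotB v L η ξ + s * Literature.MathematicalPhysics.QuantumManyBody.BoseGas.depletionB N η ξ = R.toReal * (⟪η, ξ⟫_ℂ).re) ∧ (∀ η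 ∈ M, ∀ θ ∈ M, η + θ ∈ M) ∧ (∀ η ∈ M, ∀ c : ℂ, c • η ∈ M) ∧ (∀ η ∈ M, Literature.MathematicalPhysics.QuantumManyBody.BoseGas.absLp η ∈ M) ∧ (∀ η ∈ M, Literature.MathematicalPhysics.QuantumManyBody.BoseGas.conjLp η ∈ M) ∧ (∀ η ∈ M, Literature.MathematicalPhysics.QuantumManyBody.BoseGas.maxForm v L η ≠ ⊤) ∧ (∀ (b : UnitAddTorus (Fin 3)) (η : MeasureTheory.Lp ℂ 2 (MeasureTheory.Measure.pi fun _ : Fin N × Fin 3 => (AddCircle.haarAddCircle : MeasureTheory.Measure UnitAddCircle))), η ∈ M → Literature.MathematicalPhysics.QuantumManyBody.BoseGas.translateLp b η ∈ M) ∧ IsClosed M ∧ (∃ η ∈ M, ‖η‖ = 1) ∧ (∀ (A B : ℕ → Literature.MathematicalPhysics.QuantumManyBody.BoseGas.PeriodicTrialState N L) (ε : ℕ → ENNReal), Filter.Tendsto ε Filter.atTop (nhds 0) → (∀ k, Literature.MathematicalPhysics.QuantumManyBody.BoseGas.periodicEnergy v (A k) + ENNReal.ofReal s * ((N : ENNReal)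 - Literature.MathematicalPhysics.QuantumManyBody.BoseGas.condensateOccupation N L (A k).ψ) ≤ R + ε k) → (∀ k, Literature.MathematicalPhysics.QuantumManyBody.BoseGas.periodicEnergy v (B k) + ENNReal.ofReal s * ((N : ENNReal) - Literature.MathematicalPhysics.QuantumManyBody.BoseGas.condensateOccupation N L (B k).ψ) ≤ R + ε k) → (∀ k, (∫ X in Literature.MathematicalPhysics.QuantumManyBody.BoseGas.cellN N L, starRingEnd ℂ ((A k).ψ X) * (B k).ψ X) = 0) → ∃ ηA ∈ M, ∃ ηB ∈ M, ‖ηA‖ = 1 ∧ ‖ηB‖ = 1 ∧ ⟪ηA, ηB⟫_ℂ = 0) := by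
  intro N L v s hL hv _ hs R hR M
  have hbound : ∀ ξ : Lp ℂ 2 (volume : Measure (UnitAddTorus (Fin N × Fin 3))), ξ ∈ boseSymmetric N →
      R * ENNReal.ofReal (‖ξ‖ ^ 2) ≤ maxFormR s v L ξ := fun ξ hξ =>
    iInf_rewarded_mul_le_maxFormR hv hL hs.le hξ
  refine ⟨hbound, ?_, ?_, ?_, ?_, ?_, ?_, ?_, ?_, ?_, ?_⟩
  · intro η hη ξ hξ hξfin
    exact eulerLagrange_classFR hv.1 hs.le hR hbound hη hξ hξfin
  · intro η hη θ hθ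
    exact add_mem_classFR hv.1 hs.le hR hbound hη hθ
  · intro η hη c
    exact smul_mem_classFR c hη
  · intro η hη
    exact absLp_mem_classFR hs.le hη
  · intro η hη
    exact conjLp_mem_classFR hs.le hη
  · intro η hη
    exact maxForm_ne_top_of_le hR hη.2
  · intro b η hη
    exact translateLp_mem_classFR hL b hη
  · exact isClosed_classFR hv hL hR
  · obtain ⟨η, hη, h1⟩ := exists_mem_classFR_norm_eq_one hv hL hs.le hR
    exact ⟨η, hη, h1⟩
  · intro A B ε hε hA hB horth
    obtain ⟨ηA, hηA, ηB, hηB, h⟩ := exists_orthogonal_pair_of_rewarded_le hv hL hs.le hR A B hε hA hB horth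
    exact ⟨ηA, hηA, ηB, hηB, h⟩

end Summit.AtomisticToContinuum.BoseEinsteinCondensation.Cruxes.RewardChordBound.Birth

end
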